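import Summits.QuantumFields.YangMills.Theorems.BalabanUVNodesN22W1PrintedBoxBlock
import Summits.QuantumFields.YangMills.Theorems.BalabanUVNodesN22W1RelCentredSliceInputsL2UWitness
import Literature.MathematicalPhysics.QuantumFieldTheory.Balaban1983to89.B13TermWalkDataOneTorus

/-!
# BalabanUVNodes ∕ node N22 = NE9 — A6 FOR THE PRINTED BOX BLOCK, SMALL-FIELD REGIME: `SliceInputsLGU` ∕ `SliceInputsL2U` ARE INHABITED AT A LABEL WITHOUT LARGE-FIELD BONDS WITH
# PRINT'S SMALL-FIELD BOX `Π_{b∈Λ} χ(|B′(b)| < ε₁)` ON A NONEMPTY ROW-BOND SET — the box law `hboxR` at `Rb = ε₁∕s₀`, the s-free support law `hbox` on `S₀ = univ`, the box-tail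
# rate `hRb` under the ONE window relation `e^{−(ε₁∕s₀)²∕40} ≤ (Mv − 1)·s₀²`

Cell `pub-ymgap`, HUMAN RULING D-0062 (Track A) ∕ D-0149 (width seats), seat `pub-ymgap-dag-n22-w1` (WIDTH SEAT 1 of 3 on node n22; «A6-residue flag №3 lane»), generation 0, file 5.
THEOREMS ONLY (0 `def`, 0 `sorry`); imports this seat's file 1 `…PrintedBoxBlock`, dag-n22-c's J17-W `…SliceInputsL2UWitness` (through it J12-D `SliceInputsLGU`, J17-D) and
`B13TermWalkDataOneTorus` (`freeKernels`); restates nothing.  `--kind proof --supports stmt-QuantumFields-20544 --as helper` (K3⁷ `SpineGivenEndpointR13SepCoPH`).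

WHY (standing rule №189 ∕ director-ym №193, A6).  Companion of file 4 (large-field label): here the SMALL-FIELD regime `P(t) = ∅`, where the box block's live fields are the BOX LAW
`hboxR` («χᵘχᶜᵘ = 1 on ⟨B′,B′⟩ < Rb²»), the s-free SUPPORT LAW `hbox` and the TAIL RATE `hRb`.  The tree's inhabitant J12-Wb ∕ J13b takes `χ ≡ 1` with EMPTY box support (so
`hboxR`, `hbox` are idle).  THIS FILE inhabits J12-D's `SliceInputsLGU` — and through J17-W `SliceInputsL2U` — with PRINT'S small-field box on the one row bond of the free kernels
(`χᵘ(A) = Π_{b∈Λ} χ(|A(b)| < ε₁)`, `χᶜᵘ(A) = Π_{b∈∅} …`, box support `S₀ = univ`, sup-ball radius `ρ = ε₁`): `hboxR` by file 1's `chi_mul_chic_eq_one_of_dotProduct_lt` at the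
FORCED box radius `Rb = ε₁∕s₀`, `hbox` by `chi_ne_zero_support`, `hRb : e^{−½κRb²} ≤ T·s₀²` (`κ = 1∕20`, `T = Mv − 1`) under the ONE window relation the forced radius imposes,
`e^{−(ε₁∕s₀)²∕40} ≤ (Mv − 1)·s₀²` (in place of J12-Wb's `1 < Mv` with a free `Rb`).  Everything else is J12-Wb's witness VERBATIM.

HONEST FRAMING — what this is NOT.  An INHABITATION witness at DEGENERATE kernel data with print's box SHAPE on one row bond; NOTHING of Bałaban's asserted; no joint witness with the knit's
tables ∕ numerals ∕ `hlaw` ∕ N18-below claimed; count-neutral; N22 NOT discharged (typed 28∕28 · discharged 5∕27 UNCHANGED); one finite four-torus programme at fixed ε — R4 closes the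
conditional rung `BalabanLadder.UV` only; NOT continuum, NOT OS, NOT a mass gap, NOT Clay.  0 `sorry`, standard axioms.

References (TYPES only): [II] = [Balaban1988RG2Cluster] (1.5) p. 3, (2.3) p. 12, (2.14) p. 15, (2.22) p. 16; [I] = [Balaban1987RG1] (2.9)–(2.13) pp. 266–268.
-/

noncomputable section

namespace Summit.QuantumFields.YangMills.BalabanUVNodes.N22PrintedBoxBlock

open Set Metric Matrix
open scoped BigOperators
open Literature.MathematicalPhysics.QuantumFieldTheory.Balaban1983to89
open Literature.MathematicalPhysics.QuantumFieldTheory.Balaban1983to89.TreeLengthTorus (TPt TDom tsys torusTreeLen torusTreeLen_nonneg)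
open Literature.MathematicalPhysics.QuantumFieldTheory.Balaban1983to89.B13Bound143 (invTau invTau_pos)
open Literature.MathematicalPhysics.QuantumFieldTheory.Balaban1983to89.B9Thm37GlueTorus (tdist1 tdist1_self)
open Literature.MathematicalPhysics.QuantumFieldTheory.Balaban1983to89.B5TorusCover (UT)
open Literature.MathematicalPhysics.QuantumFieldTheory.Balaban1983to89.B13TermWalkDataOneTorus (freeKernels)
open Literature.MathematicalPhysics.QuantumFieldTheory.Balaban1983to89.B13Term214 (term214 core214 F214)
open Literature.MathematicalPhysics.QuantumFieldTheory.Balaban1983to89.Step (SFConsts)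
open Literature.MathematicalPhysics.QuantumFieldTheory.Balaban1983to89.Node00
open Literature.MathematicalPhysics.QuantumFieldTheory.Balaban1983to89.Node00.Sect2 (domSys domCount CPair spaceI domSites Setting Residual)
open Literature.MathematicalPhysics.QuantumFieldTheory.Balaban1983to89.Node00.W1
open YMDAG.N22.W1 (SliceInputsLGU SliceInputsL2U)

variable (c : B13.Consts) (P : Params) (𝔸 : Type*) [NormedRing 𝔸] [NormedAlgebra ℂ 𝔸] [CompleteSpace 𝔸] (M k L : ℕ) [NeZero L]

/-! ## §1 `SliceInputsLGU` inhabited at a small-field label `P(t) = ∅` with print's small-field box on the row bond -/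

open Classical in
/-- **★ `SliceInputsLGU` IS INHABITED ON `W := univ` AT EVERY LABEL WITH `P(t) = ∅` WITH PRINT'S SMALL-FIELD BOX** `χᵘ(A) = Π_{b∈Λ} χ(|A(b)| < ε₁)` on the one row bond of the free
kernels (`χᶜᵘ = Π_{b∈∅}`, zero potentials, box support `S₀ = univ`, `ρ = ε₁`), for every nonempty domain `Z`, tables, size letters, weight letter `a`, base point `s₀ > 0`, under
the window relation `e^{−(ε₁∕s₀)²∕40} ≤ (Mv − 1)·s₀²`; `ρb = 1∕12`, `a₅ = 2`, constants as in J12-Wb.  A6 witness at degenerate kernel data; nothing of Bałaban's construction.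
[cite: Balaban1987RG1, (2.9) p.266; Balaban1988RG2Cluster, (2.3) p.12 and (2.22) p.16 (degenerate kernel data; bookkeeping)] -/
theorem sliceInputsLGU_inhabited_smallField_printedBoxes (hκ₁ : 1 ≤ c.κ₁) (hE : 0 < c.E₀) (hε : 0 < c.ε₁) (hC₁ : 0 < c.C₁) (hα : 0 < c.α₄) (hMc : 0 < c.M)
    (hδκ : 0 ≤ (1 - 3 * c.δ) * c.κ) (hpref : c.E₀ * c.ε₁ * c.C₁ * c.α₄⁻¹ * c.M ^ c.q * Real.exp (c.C₂ * c.κ₁) ≤ 1 / 2)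
    {G : Type*} [GaugeGroup G] (Sg : Setting 𝔸 G) (Rz : Residual P 𝔸) (cs : SFConsts) (E₀ κE : ℝ)
    (Z : (domSys P M (k + 1)).Dom) (hZ : 1 ≤ (Z.1).card) (t : TermLabel P M k L) (hP : t.2 = ∅)
    {s₀ Mv : ℝ} (hs₀ : 0 < s₀) (hMv : Real.exp (-((c.ε₁ / s₀) ^ 2 / 40)) ≤ (Mv - 1) * s₀ ^ 2) (a : ℝ) :
    ∃ (𝔇 : TermDatum214 c P 𝔸 M k L)
      (χu χcu : (Z : (domSys P M (k + 1)).Dom) → (t : TermLabel P M k L) → ((𝔇.𝒦 Z t).Λ → ℝ) → ℝ)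
      (𝒲 : (Z : (domSys P M (k + 1)).Dom) → (t : TermLabel P M k L) → CPair P 𝔸 → TDom P.d (L * domCount P M (k + 1)) → ((𝔇.𝒦 Z t).Λ → ℝ) → ℂ)
      (𝒪 : (Z : (domSys P M (k + 1)).Dom) → (t : TermLabel P M k L) → OlderTerms P 𝔸 M k → CPair P 𝔸 → TDom P.d (L * domCount P M (k + 1)) →
        ((𝔇.𝒦 Z t).Λ → ℝ) → ℂ),
      (∀ Z' t' A, χu Z' t' A = ∏ b ∈ (Finset.univ : Finset (𝔇.𝒦 Z' t').Λ), (if |A b| < c.ε₁ then (1 : ℝ) else 0)) ∧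
      (∀ Z' t' A, χcu Z' t' A = ∏ b ∈ (∅ : Finset (𝔇.𝒦 Z' t').Λ), (if c.ε₁ ≤ |A b| then (1 : ℝ) else 0)) ∧
      (∀ Z' t' φ Y A, 𝒲 Z' t' φ Y A = 0) ∧ (∀ Z' t' old φ Y A, 𝒪 Z' t' old φ Y A = 0) ∧
      (∀ Z' t', (Finset.univ : Finset (𝔇.𝒦 Z' t').Λ).card = 1) ∧
      Nonempty (SliceInputsLGU 𝔇 χu χcu 𝒲 𝒪 c Sg Rz cs E₀ κE Z t Set.univ s₀ a 2 (1 / 12) Mv) := by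
  haveI hNe : ∀ i : Fin 0, NeZero ((![] : Fin 0 → ℕ) i) := fun i => i.elim0
  let z : UT (![] : Fin 0 → ℕ) := UT.ofSite (N := (![] : Fin 0 → ℕ)) fun i => i.elim0
  -- W1-7's degenerate datum, kept OPAQUE (an equation `h𝔇`) so that the record's baked instances are found syntactically
  obtain ⟨𝔇, h𝔇⟩ : ∃ 𝔇 : TermDatum214 c P 𝔸 M k L, 𝔇 =
      { ν := 0, Nf := ![], E₃ := ℂ,
        𝒦 := fun _ _ => freeKernels c ℂ Unit Empty (fun _ => z) (fun _ => z),
        finC₀ := fun _ _ => inferInstanceAs (Fintype Empty),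
        decC₀ := fun _ _ => inferInstanceAs (DecidableEq Empty),
        uOf := fun _ _ _ => 0, r := 1,
        chiY₀ := fun _ _ _ _ => 0, chicP := fun _ _ _ _ => 0,
        𝒱 := fun _ _ _ _ _ _ _ => 0 } := ⟨_, rfl⟩
  -- the datum's reductions (by `subst`, each in its own `have`)
  have hA1 : ∀ (ψ : CPair P 𝔸) (σ : TPt P.d (domCount P M (k + 1)) → ℂ), 𝔇.A Z t ψ σ = 1 := by intro ψ σ; subst h𝔇; rfl
  have hG0 : ∀ (σ : TPt P.d (domCount P M (k + 1)) → ℂ) (ψ : CPair P 𝔸), (𝔇.𝒦 Z t).G2 σ (𝔇.uOf Z t ψ) = 0 := by intro σ ψ; subst h𝔇; rfl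
  have hΓ0 : (𝔇.𝒦 Z t).Γ₀ = 0 := by subst h𝔇; rfl
  have hC1 : (𝔇.𝒦 Z t).C = 1 := by subst h𝔇; rfl
  have hm : (𝔇.𝒦 Z t).m = 1 := by subst h𝔇; rfl
  have hpow : ∀ x : ℝ, x ^ 𝔇.ν = 1 := fun x => by subst h𝔇; exact pow_zero x
  have hr1 : 𝔇.r = 1 := by subst h𝔇; rfl
  have hGam : ∀ (ψ : CPair P 𝔸) (σ : TPt P.d (domCount P M (k + 1)) → ℂ) (X : (𝔇.𝒦 Z t).Λ ⊕ (𝔇.𝒦 Z t).C₀ → ℝ), 𝔇.Gam Z t ψ σ X = 0 := by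
    intro ψ σ X; rw [TermDatum214.Gam, hG0, Matrix.zero_mulVec]
  have hcardΛ : Fintype.card (𝔇.𝒦 Z t).Λ = 1 := by subst h𝔇; exact Fintype.card_unit
  have hcardΛC : Fintype.card ((𝔇.𝒦 Z t).Λ ⊕ (𝔇.𝒦 Z t).C₀) = 1 := by
    have h0 : Fintype.card (𝔇.𝒦 Z t).C₀ = 0 := Fintype.card_eq_zero_iff.2 ⟨fun x => by subst h𝔇; exact Empty.elim x⟩
    rw [Fintype.card_sum, hcardΛ, h0]
  have hcardAll : ∀ Z' t', (Finset.univ : Finset (𝔇.𝒦 Z' t').Λ).card = 1 := by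
    intro Z' t'; rw [Finset.card_univ]; subst h𝔇; exact Fintype.card_unit
  -- W1-8's located τ-letters from the elementary conditions on `c`
  have hposY : ∀ Y : TDom P.d (L * domCount P M (k + 1)), 0 < invTau c ((tsys P.d (L * domCount P M (k + 1))).dj Y) := fun Y =>
    invTau_pos c hE hε hC₁ hα hMc _
  have hhalfY : ∀ Y : TDom P.d (L * domCount P M (k + 1)), invTau c ((tsys P.d (L * domCount P M (k + 1))).dj Y) ≤ 1 / 2 := by
    intro Y
    have hd : 0 ≤ (tsys P.d (L * domCount P M (k + 1))).dj Y := torusTreeLen_nonneg Y.1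
    have hpref0 : 0 ≤ c.E₀ * c.ε₁ * c.C₁ * c.α₄⁻¹ * c.M ^ c.q * Real.exp (c.C₂ * c.κ₁) := by positivity
    unfold invTau
    calc c.E₀ * c.ε₁ * c.C₁ * c.α₄⁻¹ * c.M ^ c.q * Real.exp (c.C₂ * c.κ₁) * Real.exp (-(1 - 3 * c.δ) * c.κ * (tsys P.d (L * domCount P M (k + 1))).dj Y)
        ≤ c.E₀ * c.ε₁ * c.C₁ * c.α₄⁻¹ * c.M ^ c.q * Real.exp (c.C₂ * c.κ₁) * 1 := by
          refine mul_le_mul_of_nonneg_left (Real.exp_le_one_iff.2 ?_) hpref0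
          have : 0 ≤ (1 - 3 * c.δ) * c.κ * (tsys P.d (L * domCount P M (k + 1))).dj Y := mul_nonneg hδκ hd
          linarith
      _ ≤ 1 / 2 := by rw [mul_one]; exact hpref
  -- PRINT'S box radius in the unscaled field read at the base point: `Rb := ε₁ ∕ s₀`; the (idle) large-field threshold letter `rP² := 20·a⁺`
  have hP0 : t.2.card = 0 := by rw [hP, Finset.card_empty]
  set rP : ℝ := Real.sqrt (20 * max a 0) with hrPdef
  set Rb : ℝ := c.ε₁ / s₀ with hRbdef
  have hrPsq : rP ^ 2 = 20 * max a 0 := Real.sq_sqrt (by positivity)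
  have hRb0 : 0 ≤ Rb := div_nonneg hε.le hs₀.le
  have hRbs : Rb * s₀ ≤ c.ε₁ := by rw [hRbdef, div_mul_cancel₀ c.ε₁ hs₀.ne']
  have hA1' : ∀ ψ : CPair P 𝔸, 𝔇.A Z t ψ = fun _ => 1 := fun ψ => funext (hA1 ψ)
  have hGam' : ∀ ψ : CPair P 𝔸, 𝔇.Gam Z t ψ = fun _ _ => 0 := fun ψ => funext fun σ => funext (hGam ψ σ)
  -- print's boxes on the record's row bonds: the ONE row bond small (`Y₀l = univ`), NO large-field bond (`Pl = ∅`)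
  refine ⟨𝔇, fun Z' t' A => ∏ b ∈ (Finset.univ : Finset (𝔇.𝒦 Z' t').Λ), (if |A b| < c.ε₁ then (1 : ℝ) else 0),
    fun Z' t' A => ∏ b ∈ (∅ : Finset (𝔇.𝒦 Z' t').Λ), (if c.ε₁ ≤ |A b| then (1 : ℝ) else 0),
    fun _ _ _ _ _ => 0, fun _ _ _ _ _ _ => 0, fun _ _ _ => rfl, fun _ _ _ => rfl, fun _ _ _ _ _ => rfl, fun _ _ _ _ _ _ => rfl, hcardAll, ⟨?_⟩⟩
  exact
    { Uσ := univ,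
      Uτ := fun Y => ball 0 ((invTau c ((tsys P.d (L * domCount P M (k + 1))).dj Y))⁻¹ + 3),
      γ₂ := 1 / 20,
      rP := rP,
      qP := fun B => ∑ b ∈ (Finset.univ : Finset (𝔇.𝒦 Z t).Λ), B b ^ 2,
      kap := 3,
      kap' := 2,
      kap'' := 1,
      θ := 1 / 5,
      θE := 0,
      θΓ := 0,
      θC := 0,
      KG := 0,
      KΓ := 0,
      KCs := 1,
      K₀ := 1,
      KE := 1,
      KG' := 0,
      KCs' := ((1 - 1 / 12) ^ 2)⁻¹,
      θΓ' := 0,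
      θC' := 1 / 12 * (2 + 1 / 12) * ((1 - 1 / 12) ^ 2)⁻¹ * 1,
      θE' := 1 / 12 * (2 + 1 / 12),
      a' := 0,
      w' := 0,
      cE := 1,
      g := 0,
      Rb := Rb,
      κ := 1 / 20,
      a₀ := 0,
      w₀ := 0,
      T := Mv - 1,
      α₀ := 0,
      r₁ := 0,
      TP := 0,
      ac := 1 / 20,
      wc := 0,
      hpos := hposY,
      hhalf := hhalfY,
      hW := isOpen_univ,
      hUσ := isOpen_univ,
      hUτ := fun _ => isOpen_ball,
      hUexp := subset_univ _,
      hUtau := fun Y => closedBall_subset_ball (by linarith),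
      hr := by rw [hr1]; exact zero_lt_one,
      hr' := by rw [hr1]; linarith [Real.add_one_le_exp c.κ₁],
      hsubτ := by
        intro Y x hx w hw
        rw [Set.uIcc_of_le zero_le_one] at hx
        rw [mem_closedBall, hr1] at hw
        rw [mem_ball, dist_zero_right]
        have hx1 : ‖(x : ℂ)‖ ≤ 1 := by rw [Complex.norm_real, Real.norm_eq_abs]; exact abs_le.2 ⟨by linarith [hx.1], hx.2⟩
        have hinv : 0 < (invTau c ((tsys P.d (L * domCount P M (k + 1))).dj Y))⁻¹ := inv_pos.2 (hposY Y)
        calc ‖w‖ = ‖(w - (x : ℂ)) + (x : ℂ)‖ := by rw [sub_add_cancel]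
          _ ≤ ‖w - (x : ℂ)‖ + ‖(x : ℂ)‖ := norm_add_le _ _
          _ ≤ 1 + 1 := add_le_add (by rw [← dist_eq_norm]; exact hw) hx1
          _ < (invTau c ((tsys P.d (L * domCount P M (k + 1))).dj Y))⁻¹ + 3 := by linarith,
      hχ0 := fun B => N22PrintedBoxBlock.chi_smul_nonneg _ Finset.univ c.ε₁ (fun _ => rfl) s₀ B,
      hχc0 := fun B => N22PrintedBoxBlock.chic_smul_nonneg _ ∅ c.ε₁ (fun _ => rfl) s₀ B,
      hχm := N22PrintedBoxBlock.measurable_chi_smul _ Finset.univ c.ε₁ (fun _ => rfl) s₀,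
      hχcm := N22PrintedBoxBlock.measurable_chic_smul _ ∅ c.ε₁ (fun _ => rfl) s₀,
      h222 := fun B => by
        rw [hP0, Nat.cast_zero, mul_zero, neg_zero, zero_add]
        refine (N22PrintedBoxBlock.chi_mul_chic_le_one _ _ Finset.univ ∅ c.ε₁ (fun _ => rfl) (fun _ => rfl) s₀ B).trans ?_
        exact Real.one_le_exp (mul_nonneg (by norm_num) (Finset.sum_nonneg fun i _ => sq_nonneg (B i))),
      hγ₂ := by norm_num,
      hqP := fun B => N22PrintedBoxBlock.sum_sq_le_dotProduct Finset.univ B,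
      hAhol := fun _ _ i j => by simp only [hA1]; exact differentiableOn_const _,
      hGhol := fun _ _ i j => by simp only [hG0]; exact differentiableOn_const _,
      hAd := fun σ _ i j => by simp only [hA1]; exact differentiableOn_const _,
      hGd := fun σ _ i j => by simp only [hG0]; exact differentiableOn_const _,
      hAs := fun _ _ σ _ => by rw [hA1]; exact Matrix.isSymm_one,
      hfibN := fun x => (Finset.card_filter_le _ _).trans (by rw [Finset.card_univ, hcardΛC, hm]),
      hkap'' := by norm_num,
      hk1 := by norm_num,
      hk2 := by norm_num,
      hθE := le_rfl,
      hθΓ := le_rfl,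
      hθC := le_rfl,
      hKG := le_rfl,
      hKΓ := le_rfl,
      hKCs := zero_le_one,
      hK₀ := zero_le_one,
      hKE := zero_le_one,
      hG := fun _ _ σ _ b j => by rw [hG0, Matrix.zero_apply, norm_zero, zero_mul],
      hΓ₀ := fun b j => by rw [hΓ0, Matrix.zero_apply, norm_zero, zero_mul],
      hCs := fun _ _ σ _ b b' => by
        rw [hA1, inv_one]
        by_cases hb : b = b'
        · subst hb; rw [Matrix.one_apply_eq, norm_one, tdist1_self, mul_zero, neg_zero, Real.exp_zero, mul_one]
        · rw [Matrix.one_apply_ne hb, norm_zero]; positivity,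
      hC216 := fun b b' => by
        rw [hC1]
        by_cases hb : b = b'
        · subst hb; rw [Matrix.one_apply_eq, norm_one, tdist1_self, mul_zero, neg_zero, Real.exp_zero, mul_one]
        · rw [Matrix.one_apply_ne hb, norm_zero]; positivity,
      hCE := fun b b' => by
        rw [hC1, inv_one, Matrix.map_one _ (map_zero _) (map_one _)]
        by_cases hb : b = b'
        · subst hb; rw [Matrix.one_apply_eq, norm_one, tdist1_self, mul_zero, neg_zero, Real.exp_zero, mul_one]
        · rw [Matrix.one_apply_ne hb, norm_zero]; positivity,
      hdΓ := fun _ _ σ _ b j => by rw [hG0, hΓ0, Matrix.map_zero _ (map_zero _), sub_zero, Matrix.zero_apply, norm_zero, zero_mul],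
      hdC := fun _ _ σ _ b b' => by rw [hA1, hC1, inv_one, Matrix.map_one _ (map_zero _) (map_one _), sub_self, Matrix.zero_apply, norm_zero, zero_mul],
      hdE := fun _ _ σ _ b b' => by rw [hA1, hC1, inv_one, Matrix.map_one _ (map_zero _) (map_one _), sub_self, Matrix.zero_apply, norm_zero, zero_mul],
      hKG' := by norm_num,
      hKCs' := by norm_num,
      hθΓ' := by norm_num,
      hθC' := by norm_num,
      hθE' := by norm_num,
      hθEle := by norm_num,
      hθΓle := by norm_num,
      hθR1le := by simp only [hpow, hm, Nat.cast_one, mul_one]; norm_num,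
      hsmallKθ := by simp only [hpow, hm, Nat.cast_one, mul_one]; norm_num,
      hc0 := zero_le_one,
      hc := fun i => by
        haveI : Nonempty (𝔇.𝒦 Z t).Λ := ⟨i⟩
        have h : (𝔇.𝒦 Z t).hC.1.eigenvalues i ∈ spectrum ℝ (1 : Matrix (𝔇.𝒦 Z t).Λ (𝔇.𝒦 Z t).Λ ℝ) := by
          have h0 := (𝔇.𝒦 Z t).hC.1.eigenvalues_mem_spectrum_real i
          rwa [show spectrum ℝ (𝔇.𝒦 Z t).C = spectrum ℝ (1 : Matrix (𝔇.𝒦 Z t).Λ (𝔇.𝒦 Z t).Λ ℝ) by rw [hC1]] at h0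
        rw [spectrum.one_eq, Set.mem_singleton_iff] at h
        exact h.le,
      hαc := by simp only [hpow, hm, Nat.cast_one, mul_one]; norm_num,
      hg := le_rfl,
      hΓq := fun X => by rw [hΓ0, Matrix.zero_mulVec, zero_dotProduct, zero_mul],
      hsmall := by simp only [hpow, hm, Nat.cast_one, mul_one]; norm_num,
      hPa := by rw [hrPsq]; nlinarith [le_max_left a 0, le_max_right a 0],
      hvol := by
        have h1 : (1 : ℝ) ≤ ((Z.1).card : ℝ) := Nat.one_le_cast.mpr hZ
        simp only [hpow, hm, hcardΛ, hcardΛC, Nat.cast_one, mul_one, one_mul]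
        nlinarith [h1],
      hχe := fun B => N22PrintedBoxBlock.chi_smul_neg _ Finset.univ c.ε₁ (fun _ => rfl) s₀ B,
      hχce := fun B => N22PrintedBoxBlock.chic_smul_neg _ ∅ c.ε₁ (fun _ => rfl) s₀ B,
      hαc_c := by simp only [hpow, hm, Nat.cast_one, mul_one]; norm_num,
      hsmall_c := by simp only [hpow, hm, Nat.cast_one, mul_one]; norm_num,
      hvol_c := by
        have h1 : (1 : ℝ) ≤ ((Z.1).card : ℝ) := Nat.one_le_cast.mpr hZ
        simp only [hpow, hm, hcardΛ, hcardΛC, Nat.cast_one, mul_one, one_mul]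
        nlinarith [h1],
      hχ1 := fun _ B => N22PrintedBoxBlock.chi_mul_chic_le_one _ _ Finset.univ ∅ c.ε₁ (fun _ => rfl) (fun _ => rfl) s₀ B,
      hκ := by norm_num,
      hboxR := fun _ B hB => N22PrintedBoxBlock.chi_mul_chic_eq_one_of_dotProduct_lt _ _ Finset.univ ∅ c.ε₁ (fun _ => rfl) (fun _ => rfl) rfl hs₀ hRb0 hRbs B hB,
      ha₀ := le_rfl,
      hαc_b := by simp only [hpow, hm, Nat.cast_one, mul_one]; norm_num,
      hsmall_b := by simp only [hpow, hm, Nat.cast_one, mul_one]; norm_num,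
      hvol_b := by
        have h1 : (1 : ℝ) ≤ ((Z.1).card : ℝ) := Nat.one_le_cast.mpr hZ
        simp only [hpow, hm, hcardΛ, hcardΛC, Nat.cast_one, mul_one, one_mul]
        nlinarith [h1],
      hα₀ := le_rfl,
      hαc_f := by simp only [hpow, hm, Nat.cast_one, mul_one]; norm_num,
      hsmall_f := by simp only [hpow, hm, Nat.cast_one, mul_one]; norm_num,
      hr₁ := fun h => absurd hP h,
      hPa1 := fun h => absurd hP h,
      hA := fun _ _ σ _ => by rw [hA1, Matrix.map_one _ Complex.zero_re Complex.one_re]; exact Matrix.PosDef.one,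
      hθEle0 := by norm_num,
      hθΓle0 := by norm_num,
      hθR1le0 := by simp only [hpow, hm, Nat.cast_one, mul_one]; norm_num,
      hαc_0 := by simp only [hpow, hm, Nat.cast_one, mul_one]; norm_num,
      hsmall_0 := by simp only [hpow, hm, Nat.cast_one, mul_one]; norm_num,
      hvol_0 := by
        have h1 : (1 : ℝ) ≤ ((Z.1).card : ℝ) := Nat.one_le_cast.mpr hZ
        simp only [hpow, hm, hcardΛ, hcardΛC, Nat.cast_one, mul_one, one_mul]
        nlinarith [h1],
      hRb := fun _ => by
        have : -(1 / 20 / 2 * (c.ε₁ / s₀) ^ 2) = -((c.ε₁ / s₀) ^ 2 / 40) := by ring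
        rw [this]
        exact hMv,
      hTP := fun h => absurd hP h,
      hMvT := fun _ => by linarith,
      hMvP := fun h => absurd hP h,
      𝒲₃ := fun _ _ => 0,
      D𝒪 := fun _ _ _ => 0,
      ρ := c.ε₁,
      hρ := hε,
      h𝒲m := fun _ _ _ => measurable_const,
      h𝒲d := fun _ _ => differentiableOn_const _,
      h𝒲₃m := fun _ => measurable_const,
      h𝒲₃ := fun _ _ _ => by rw [mul_zero],
      R := fun Y => (invTau c ((tsys P.d (L * domCount P M (k + 1))).dj Y))⁻¹ + 3,
      c₀ := fun _ => 0,
      c₃ := fun _ => 0,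
      c₃' := fun _ => 0,
      c₄ := fun _ => 0,
      c₁ := fun _ => 0,
      c₁' := fun _ => 0,
      c₂ := fun _ => 0,
      hR := fun Y _ => by have := inv_pos.2 (hposY Y); linarith,
      hc₃ := fun _ _ => le_rfl,
      hc₃' := fun _ _ => le_rfl,
      hc₄ := fun _ _ => le_rfl,
      hc₁ := fun _ _ => le_rfl,
      hc₁' := fun _ _ => le_rfl,
      hc₂ := fun _ _ => le_rfl,
      hUτR := fun Y _ w hw => by rw [mem_ball, dist_zero_right] at hw; exact hw.le,
      h1 := fun _ _ _ _ _ _ => by rw [norm_zero, zero_mul],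
      S := fun _ => ∅,
      h1loc := fun _ _ _ _ _ _ => by rw [norm_zero, zero_mul, zero_mul],
      cubeOf := fun _ _ => 0,
      hS := fun _ _ b hb => absurd hb (Finset.notMem_empty _),
      Cp := 0,
      κp := B12TreeDecay.kappa₀ (4 * 2 ^ P.d) (2 * P.d),
      hCp := le_rfl,
      hκp := le_rfl,
      hdecay := fun _ _ => by rw [mul_zero, zero_mul],
      h2 := fun _ _ _ _ _ _ => by rw [sub_zero, norm_zero, zero_mul],
      h3 := fun _ _ _ => by rw [norm_zero, zero_mul],
      S₀ := Set.univ,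
      hbox := fun A hA b _ => (N22PrintedBoxBlock.chi_ne_zero_support _ Finset.univ c.ε₁ (fun _ => rfl) A hA b (Finset.mem_univ b)).le,
      hloc𝒲 := fun _ _ _ _ _ _ _ => rfl,
      δ := 1 / 40,
      hδ := by norm_num,
      h𝒪m := fun _ _ _ _ _ => measurable_const,
      h𝒪d := fun _ _ _ _ => differentiableOn_const _,
      hD𝒪m := fun _ _ _ => measurable_const,
      hD𝒪 := fun _ _ _ _ _ => by rw [mul_zero],
      h0 := fun _ _ _ _ _ _ => by rw [norm_zero],
      h4 := fun _ _ _ _ _ _ _ _ => by rw [sub_zero, norm_zero, zero_mul],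
      h5 := fun _ _ _ _ _ _ _ _ => by rw [sub_zero, sub_zero, norm_zero, zero_mul],
      h6 := fun _ _ _ _ _ => by rw [norm_zero, zero_mul],
      hloc𝒪 := fun _ _ _ _ _ _ _ _ _ => rfl,
      hOhol := fun _ _ O _ cv _ _ Y A => differentiableOn_const _,
      ha' := by norm_num,
      hw' := by simp,
      hac := by norm_num,
      hwc := by simp,
      hw₀ := by simp }


/-! ## §2 Transported to the Lemma-2 record `SliceInputsL2U` (J17-W) -/

open Classical in
/-- **★ `SliceInputsL2U` IS INHABITED AT A SMALL-FIELD LABEL WITH PRINT'S SMALL-FIELD BOX** (`E₀ ≥ 0`; J17-W's transport at `ξ₀ := 0`, `old₀ := 0`).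
[cite: Balaban1987RG1, (2.9) p.266; Balaban1988RG2Cluster, (2.3) p.12 and Lemma 2 p.11 (degenerate data; bookkeeping)] -/
theorem sliceInputsL2U_inhabited_smallField_printedBoxes (hκ₁ : 1 ≤ c.κ₁) (hE : 0 < c.E₀) (hε : 0 < c.ε₁) (hC₁ : 0 < c.C₁) (hα : 0 < c.α₄) (hMc : 0 < c.M)
    (hδκ : 0 ≤ (1 - 3 * c.δ) * c.κ) (hpref : c.E₀ * c.ε₁ * c.C₁ * c.α₄⁻¹ * c.M ^ c.q * Real.exp (c.C₂ * c.κ₁) ≤ 1 / 2)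
    {G : Type*} [GaugeGroup G] (Sg : Setting 𝔸 G) (Rz : Residual P 𝔸) (cs : SFConsts) {E₀ : ℝ} (hE₀ : 0 ≤ E₀) (κE : ℝ)
    (Z : (domSys P M (k + 1)).Dom) (hZ : 1 ≤ (Z.1).card) (t : TermLabel P M k L) (hP : t.2 = ∅)
    {s₀ Mv : ℝ} (hs₀ : 0 < s₀) (hMv : Real.exp (-((c.ε₁ / s₀) ^ 2 / 40)) ≤ (Mv - 1) * s₀ ^ 2) (a : ℝ) :
    ∃ (𝔇 : TermDatum214 c P 𝔸 M k L)
      (χu χcu : (Z : (domSys P M (k + 1)).Dom) → (t : TermLabel P M k L) → ((𝔇.𝒦 Z t).Λ → ℝ) → ℝ)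
      (𝒲 : (Z : (domSys P M (k + 1)).Dom) → (t : TermLabel P M k L) → CPair P 𝔸 → TDom P.d (L * domCount P M (k + 1)) → ((𝔇.𝒦 Z t).Λ → ℝ) → ℂ)
      (𝒪 : (Z : (domSys P M (k + 1)).Dom) → (t : TermLabel P M k L) → OlderTerms P 𝔸 M k → CPair P 𝔸 → TDom P.d (L * domCount P M (k + 1)) →
        ((𝔇.𝒦 Z t).Λ → ℝ) → ℂ),
      (∀ Z' t' A, χu Z' t' A = ∏ b ∈ (Finset.univ : Finset (𝔇.𝒦 Z' t').Λ), (if |A b| < c.ε₁ then (1 : ℝ) else 0)) ∧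
      (∀ Z' t' A, χcu Z' t' A = ∏ b ∈ (∅ : Finset (𝔇.𝒦 Z' t').Λ), (if c.ε₁ ≤ |A b| then (1 : ℝ) else 0)) ∧
      (∀ Z' t', (Finset.univ : Finset (𝔇.𝒦 Z' t').Λ).card = 1) ∧
      Nonempty (SliceInputsL2U 𝔇 χu χcu 𝒲 𝒪 c Sg Rz cs E₀ κE Z t Set.univ s₀ a 2 (1 / 12) Mv) := by
  obtain ⟨𝔇, χu, χcu, 𝒲, 𝒪, hχu, hχcu, h𝒲, h𝒪, hcard, ⟨U⟩⟩ :=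
    sliceInputsLGU_inhabited_smallField_printedBoxes c P 𝔸 M k L hκ₁ hE hε hC₁ hα hMc hδκ hpref Sg Rz cs E₀ κE Z hZ t hP hs₀ hMv a
  exact ⟨𝔇, χu, χcu, 𝒲, 𝒪, hχu, hχcu, hcard,
    SliceInputsLGU.nonempty_sliceInputsL2U_of_vanishing U (h𝒲 Z t) (h𝒪 Z t) (Set.mem_univ (0 : CPair P 𝔸))
      (YMDAG.N22.W1.zero_mem_AdmHist_of_nonneg P 𝔸 M _ hE₀ κE)⟩

end Summit.QuantumFields.YangMills.BalabanUVNodes.N22PrintedBoxBlock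

end
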